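import Literature.Analysis.FluidPDE.AxisymHouLiVariables
import Literature.Analysis.FluidPDE.Wei2016Lemma23
import Literature.Analysis.FluidPDE.Wei2016SupLemma
import Literature.Analysis.FluidPDE.Wei2016HalfPlane
import HarnessLib

/-!
# Wei 2016, Lemma 2.2 on `ℝ³`: `a(t)² ≤ ‖J‖_{L²} ‖u_θ/r‖_{L²}`

Analysis/FluidPDE proof file (theorems only) on the way to
`Literature.Analysis.FluidPDE.Wei2016_logModulus_regularity`
(`LeiZhang2017AxisymmetricCriteria.lean`), after

* D. Wei, *Regularity criterion to the axially symmetric Navier–Stokes equations*, J. Math.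
  Anal. Appl. 435 (2016) 402–413 = arXiv:1508.03318, §2, Lemma 2.2: with
  `v(r, z, t) = ∫₀ʳ |u_θ(r', z, t)| dr'` and `a(t) = ‖v/r‖_{L^∞}`,
  `a(t)² ≤ ‖J(t)‖_{L²} ‖(u_θ/r)(t)‖_{L²}`, `J = −∂_z(u_θ/r)`.

The half-plane form is the tree's `Wei2016.sq_integral_le_mul_sqrt` (`Wei2016SupLemma.lean`);
this file transfers it to `ℝ³` in the smooth Hou–Li variable `Φ = u_θ/r = angVelQuot u`
(`AxisymHouLiVariables.lean`, smooth across the axis) and its axial derivative `∂_zΦ = −J`: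

* `Wei2016.hasDerivAt_meridianPoint_snd` — `d/dz (ρ, 0, z) = e_z`;
* `Wei2016.sq_integral_abs_swirlVelocity_le` — for an axisymmetric `u ∈ C⁴` with
  `Φ, ∂_zΦ ∈ L²` and every `r' > 0`, `z'`:
  `(∫₀^{r'} |u_θ(s, 0, z')| ds)² ≤ r'² √(∫ (∂_zΦ)² dx · ∫ Φ² dx) / c₂`, `c₂ = 2π`
  (the paper's `‖f‖²_{L²} = ∫ |f|² r dr dz` is `c₂⁻¹ ∫ |f|² dx`, so this is exactly
  `(v/r')² ≤ ‖J‖ ‖u_θ/r‖` in the paper's normalisation, for every `(r', z')`, whence for the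
  sup `a(t)`).

Proof: the half-plane lemma for the profiles `H(ρ, z) = Φ(ρ, 0, z)`, `H_z = ∂_zΦ(ρ, 0, z)`,
whose weighted squares are integrable on the half-plane with `c₂ ∫∫ ρ H_z² = ∫ (∂_zΦ)² dx`,
`c₂ ∫∫ ρ H² = ∫ Φ² dx` (`Wei2016HalfPlane.lean`), and `|u_θ| = ρ |H|` along the ray
(`r² Φ = Γ = ρ u_θ` on the meridian half-plane).

## References

* D. Wei, arXiv:1508.03318, §2, Lemma 2.2. [Wei2016]
-/

noncomputable section

open MeasureTheory Set Function Filter Topology intervalIntegral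
open scoped RealInnerProductSpace

namespace Literature.Analysis.FluidPDE

namespace Wei2016

variable {u : EuclideanSpace ℝ (Fin 3) → EuclideanSpace ℝ (Fin 3)}

/-! ### Lemma 2.2 on `ℝ³` -/

/-- The meridian point depends affinely on `z`: `d/dz (ρ, 0, z) = e_z`. [folklore] -/
theorem hasDerivAt_meridianPoint_snd (ρ z : ℝ) :
    HasDerivAt (fun z : ℝ => meridianPoint (ρ, z)) eZ z := by
  have h : (fun z : ℝ => meridianPoint (ρ, z)) = fun z => z • eZ + meridianPoint (ρ, 0) := by
    funext z
    ext i
    fin_cases i <;> simp [meridianPoint, eZ]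
  rw [h]
  simpa using ((hasDerivAt_id z).smul_const eZ).add_const (meridianPoint (ρ, 0))

/-- Along the meridian half-plane `|u_θ(s, 0, z)| = s |Φ(s, 0, z)|`, `Φ = u_θ/r`, for an
axisymmetric `u ∈ C²` and `s ≥ 0` (`r² Φ = Γ = s u₁` there). [folklore] -/
theorem abs_swirlVelocity_meridianPoint_eq_mul (hu : IsAxisymmetric u) (hud : ContDiff ℝ 2 u)
    {s : ℝ} (hs : 0 ≤ s) (z : ℝ) :
    |swirlVelocity u (meridianPoint (s, z))| = s * |angVelQuot u (meridianPoint (s, z))| := by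
  rcases hs.eq_or_lt with rfl | hs'
  · -- on the axis `u₁ = 0`
    rw [abs_swirlVelocity_meridianPoint hu, zero_mul]
    have h := (apply_zero_one_eq_zero_of_axis hu (x := meridianPoint (0, z))
      (by simp [meridianPoint]) (by simp [meridianPoint])).2
    rw [h, abs_zero]
  · have h := hu.cylRadius_sq_mul_angVelQuot hud (meridianPoint (s, z))
    rw [cylRadius_meridianPoint_eq_abs, abs_of_pos hs', swirl_meridianPoint] at h
    -- `s² Φ = s u₁`, so `u₁ = s Φ`
    have h1 : u (meridianPoint (s, z)) 1 = s * angVelQuot u (meridianPoint (s, z)) := by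
      have := mul_left_cancel₀ hs'.ne' (show s * u (meridianPoint (s, z)) 1 =
        s * (s * angVelQuot u (meridianPoint (s, z))) by rw [← h]; ring)
      exact this
    rw [abs_swirlVelocity_meridianPoint hu, h1, abs_mul, abs_of_pos hs']

/-- **Wei 2016, Lemma 2.2 on `ℝ³`: `a(t)² ≤ ‖J‖_{L²} ‖u_θ/r‖_{L²}`.** For an axisymmetric `C⁴`
field `u` whose smooth quotient `Φ = u_θ/r = angVelQuot u` and its axial derivative
`∂_zΦ = −J` are square integrable, and every `r' > 0`, `z'`:
`v(r', z')² = (∫₀^{r'} |u_θ(s, 0, z')| ds)² ≤ r'² √(∫ (∂_zΦ)² dx · ∫ Φ² dx) / c₂`, `c₂ = 2π`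
(in the paper's normalisation `‖f‖²_{L²} = ∫ |f|² r dr dz = c₂⁻¹ ∫ |f|² dx` this reads
`(v/r')² ≤ ‖J‖_{L²} ‖u_θ/r‖_{L²}` for every `(r', z')`, i.e. `a(t)² ≤ ‖J‖ ‖u_θ/r‖`).
Proof: the half-plane Lemma 2.2 (`sq_integral_le_mul_sqrt`, `Wei2016SupLemma.lean`) for the
profiles `H(ρ, z) = Φ(ρ, 0, z)`, `H_z = ∂_zΦ(ρ, 0, z)`, whose weighted squares are integrable on
the half-plane with `c₂ ∫∫ ρ H_z² = ∫ (∂_zΦ)² dx`, `c₂ ∫∫ ρ H² = ∫ Φ² dx`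
(`Wei2016HalfPlane.lean`); `|u_θ| = ρ |H|` along the ray
(`abs_swirlVelocity_meridianPoint_eq_mul`). [cite: Wei2016, Lemma 2.2] -/
theorem sq_integral_abs_swirlVelocity_le (hu : IsAxisymmetric u) (hud : ContDiff ℝ 4 u)
    (hJi : Integrable fun x => fderiv ℝ (angVelQuot u) x eZ ^ 2)
    (hqi : Integrable fun x => angVelQuot u x ^ 2) {r' : ℝ} (hr' : 0 < r') (z' : ℝ) :
    (∫ s in (0 : ℝ)..r', |swirlVelocity u (meridianPoint (s, z'))|) ^ 2 ≤
      r' ^ 2 * Real.sqrt ((∫ x, fderiv ℝ (angVelQuot u) x eZ ^ 2) * ∫ x, angVelQuot u x ^ 2) /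
        radialConst₂ := by
  have hq2 : ContDiff ℝ 2 (angVelQuot u) := contDiff_angVelQuot (n := 2) (by exact_mod_cast hud)
  have hu2 : ContDiff ℝ 2 u := hud.of_le (by norm_num)
  have hqd : Differentiable ℝ (angVelQuot u) := hq2.differentiable (by norm_num)
  have hqc : Continuous (angVelQuot u) := hq2.continuous
  have hDqc : Continuous (fderiv ℝ (angVelQuot u)) := hq2.continuous_fderiv (by norm_num)
  have hax : IsAxisymmetricScalar (angVelQuot u) := hu.isAxisymmetricScalar_angVelQuot hu2
  -- the profiles
  set H : ℝ → ℝ → ℝ := fun ρ z => angVelQuot u (meridianPoint (ρ, z)) with hH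
  set Hz : ℝ → ℝ → ℝ := fun ρ z => fderiv ℝ (angVelQuot u) (meridianPoint (ρ, z)) eZ with hHz
  have hmpc : Continuous fun p : ℝ × ℝ => meridianPoint (p.1, p.2) :=
    (contDiff_meridianPoint (n := 0)).continuous
  have hHc : Continuous (uncurry H) := hqc.comp hmpc
  have hHzc : Continuous (uncurry Hz) := (hDqc.comp hmpc).clm_apply continuous_const
  have hderiv : ∀ ρ, 0 < ρ → ∀ z, HasDerivAt (H ρ) (Hz ρ z) z := fun ρ _ z =>
    (hqd _).hasFDerivAt.comp_hasDerivAt z (hasDerivAt_meridianPoint_snd ρ z)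
  -- the two weighted squares are integrable on the half-plane, with the stated values
  have hGJ : IsAxisymmetricScalar fun x => fderiv ℝ (angVelQuot u) x eZ ^ 2 := by
    have h := hax.fderiv_apply_single_two hqd
    intro θ x
    have h' := h θ x
    simp only [eZ] at h' ⊢
    simp only [h']
  have hGJc : Continuous fun x => fderiv ℝ (angVelQuot u) x eZ ^ 2 :=
    (hDqc.clm_apply continuous_const).pow 2
  have hGq : IsAxisymmetricScalar fun x => angVelQuot u x ^ 2 := fun θ x => by
    simp only [hax θ x]
  have hX := integrable_weightedProfile hGJ hGJc hJi
  have hY := integrable_weightedProfile hGq (hqc.pow 2) hqi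
  have hXv := integral_weightedProfile hGJ hGJc hJi
  have hYv := integral_weightedProfile hGq (hqc.pow 2) hqi
  -- the half-plane lemma
  have hmain := sq_integral_le_mul_sqrt (H := H) (Hz := Hz) hHc hHzc hderiv hX hY hr' z'
  -- the left-hand side: `|u_θ(s, 0, z')| = s |H(s, z')|` on `[0, r']`
  have hL : ∫ s in (0 : ℝ)..r', |swirlVelocity u (meridianPoint (s, z'))| =
      ∫ s in (0 : ℝ)..r', s * |H s z'| := by
    refine intervalIntegral.integral_congr fun s hs => ?_
    rw [uIcc_of_le hr'.le] at hs
    exact abs_swirlVelocity_meridianPoint_eq_mul hu hu2 hs.1 z'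
  -- the right-hand side: `X = c₂⁻¹ ∫ (∂_zΦ)²`, `Y = c₂⁻¹ ∫ Φ²`
  have hc₂ := radialConst₂_pos
  have hXe : ∫ p in Ioi (0 : ℝ) ×ˢ (univ : Set ℝ), p.1 * Hz p.1 p.2 ^ 2 =
      (∫ x, fderiv ℝ (angVelQuot u) x eZ ^ 2) / radialConst₂ := by
    rw [eq_div_iff hc₂.ne', mul_comm, ← hXv]
  have hYe : ∫ p in Ioi (0 : ℝ) ×ˢ (univ : Set ℝ), p.1 * H p.1 p.2 ^ 2 =
      (∫ x, angVelQuot u x ^ 2) / radialConst₂ := by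
    rw [eq_div_iff hc₂.ne', mul_comm, ← hYv]
  rw [hL]
  refine hmain.trans (le_of_eq ?_)
  rw [hXe, hYe, show (∫ x, fderiv ℝ (angVelQuot u) x eZ ^ 2) / radialConst₂ *
      ((∫ x, angVelQuot u x ^ 2) / radialConst₂) =
    ((∫ x, fderiv ℝ (angVelQuot u) x eZ ^ 2) * ∫ x, angVelQuot u x ^ 2) / radialConst₂ ^ 2 by ring,
    Real.sqrt_div' _ (sq_nonneg _), Real.sqrt_sq hc₂.le]
  ring

end Wei2016

end Literature.Analysis.FluidPDE

end
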